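import Literature.Computability.Complexity.SymmetricWeisfeilerLeman
import Literature.Computability.Complexity.SymmetricColourRefinementSemantics
import Literature.ModelTheory.FiniteModelTheory.WeisfeilerLemanColoured
import HarnessLib

/-!
# Symmetric threshold circuits deciding `k`-WL equivalence with a fixed target, III: semantics

Continuation of `SymmetricWeisfeilerLeman.lean`. For the DAG `SymWL.wlDAG tgt` evaluated on an input
`x : (Fin m × Fin m) ⊕ Fin m → Bool`, read as the coloured graph `(G, c)` with
`G = SimpleGraph.fromRel (x (inl (·,·)) = true)` and `c u = x (inr u)`, and for a target `tgt` whose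
literal bits are those of a coloured graph `(H, d)` on `Fin m` and whose count thresholds are the
TRUE counts of the coloured `k`-WL colours of `(H, d)` (`Literature/ModelTheory/FiniteModelTheory/
WeisfeilerLemanColoured.lean`), every gate computes what its name says:

* `SymWL.val_Mw` — the match wire of round `t ≤ T` carries `[C_t(G,c; ū) = C_t(H,d; ī)]`
  (induction on `t`; the step `SymWL.val_ms_iff` is the evaluation of the counting gadget: given the
  round-`t` match of `ū` with `ī`, the gate `ag t ū ī w w'` fires iff the new vertex `w` realises
  over `ū` the same value `(atpC(ū w), (C_t(ū[j ↦ w]))ⱼ)` as `w'` does over `ī`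
  (`SymWL.val_ag_iff_of_match`), the padded majorities count these `w` exactly
  (`SymWL.counter_iff`), and two multisets over equinumerous index types agree iff every value of
  the second is taken equally often by both (`SymWL.map_univ_eq_iff_card_fiber`));
* `SymWL.val_out`, `SymWL.compile_wlDAG_eval_iff` — the output carries
  `[wlColoursC k G c T = wlColoursC k H d T]`, i.e. (by the explicit stable round of
  `WeisfeilerLemanColoured.lean`, when `T ≥ m^k · m^k`) `[(G,c) ≡_{k-WL} (H,d)]`
  (`SymWL.compile_wlDAG_eval_iff_wlEquivC`).

The target is kept abstract (`tgt` with hypotheses `hadj`, `hcol`, `hnA`, `hnO`) so that this file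
declares nothing; users build the target with the anonymous constructor.

## References

* [AndersonDawar2016] M. Anderson, A. Dawar, *On symmetric circuits and fixed-point logics*,
  Theory Comput. Syst. 60 (2017), Thm 1, §3.
* [CaiFurerImmerman1992] Cai–Fürer–Immerman, Combinatorica 12 (1992), §5 (k-dim W-L refinement).
-/

namespace Literature.Computability.Complexity

open Finset Literature.ModelTheory.FiniteModelTheory

namespace SymWL

open Node

variable {m k T : ℕ}

/-! ### Three combinatorial tools -/

/-- Equality of coloured atomic types, entrywise: the `{0,1,2}`-relations of all pairs of entries
and the colours of all entries agree. [folklore] -/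
theorem atpC_eq_iff {V W κ : Type*} [DecidableEq V] [DecidableEq W] {G : SimpleGraph V}
    {H : SimpleGraph W} [DecidableRel G.Adj] [DecidableRel H.Adj] {c : V → κ} {d : W → κ} {n : ℕ}
    (ū : Fin n → V) (ī : Fin n → W) :
    atpC G c ū = atpC H d ī ↔
      (∀ i j, (if ū i = ū j then (2 : Fin 3) else if G.Adj (ū i) (ū j) then 1 else 0) =
        (if ī i = ī j then (2 : Fin 3) else if H.Adj (ī i) (ī j) then 1 else 0)) ∧
      ∀ j, c (ū j) = d (ī j) := by
  simp only [atpC, Prod.mk.injEq]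
  refine and_congr ⟨fun h i j => congrFun (congrFun h i) j, fun h => funext fun i => funext (h i)⟩
    ⟨fun h j => congrFun h j, fun h => funext h⟩

/-- Extending two tuples of equal coloured atomic type by one vertex each: the extended types agree
iff the new LAST COLUMNS (relations of the old entries to the new vertex) and the colours of the new
vertices agree — the last row is the transpose, the corner is `2`. [folklore] -/
theorem atpC_snoc_eq_iff {V W κ : Type*} [DecidableEq V] [DecidableEq W] {G : SimpleGraph V}
    {H : SimpleGraph W} [DecidableRel G.Adj] [DecidableRel H.Adj] {c : V → κ} {d : W → κ} {n : ℕ}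
    {ū : Fin n → V} {ī : Fin n → W} (h : atpC G c ū = atpC H d ī) (w : V) (w' : W) :
    atpC G c (Fin.snoc ū w : Fin (n + 1) → V) = atpC H d (Fin.snoc ī w' : Fin (n + 1) → W) ↔
      (∀ j, (if ū j = w then (2 : Fin 3) else if G.Adj (ū j) w then 1 else 0) =
        (if ī j = w' then (2 : Fin 3) else if H.Adj (ī j) w' then 1 else 0)) ∧ c w = d w' := by
  rw [atpC_eq_iff] at h ⊢
  obtain ⟨hrel, hc⟩ := h
  constructor
  · rintro ⟨h1, h2⟩
    refine ⟨fun j => ?_, ?_⟩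
    · simpa [Fin.snoc_castSucc, Fin.snoc_last] using h1 (Fin.castSucc j) (Fin.last n)
    · simpa [Fin.snoc_last] using h2 (Fin.last n)
  · rintro ⟨h1, h2⟩
    refine ⟨fun i j => ?_, fun j => ?_⟩
    · refine Fin.lastCases ?_ (fun i => ?_) i <;> refine Fin.lastCases ?_ (fun j => ?_) j
      · simp [Fin.snoc_last]
      · have := h1 j
        simp only [Fin.snoc_last, Fin.snoc_castSucc, @eq_comm _ w (ū j), @eq_comm _ w' (ī j),
          G.adj_comm w (ū j), H.adj_comm w' (ī j)]
        exact this
      · simpa [Fin.snoc_last, Fin.snoc_castSucc] using h1 i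
      · simpa [Fin.snoc_castSucc] using hrel i j
    · refine Fin.lastCases ?_ (fun j => ?_) j
      · simpa [Fin.snoc_last] using h2
      · simpa [Fin.snoc_castSucc] using hc j

/-- The multiplicity of a value in the multiset of values of a finite family is the size of its
fibre. [folklore] -/
theorem count_map_univ {δ γ : Type*} [Fintype δ] [DecidableEq γ] (e : δ → γ) (y : γ) :
    Multiset.count y ((univ : Finset δ).val.map e) = (univ.filter fun a => e a = y).card := by
  rw [Multiset.count_map, Finset.card_def, Finset.filter_val]
  congr 1
  exact Multiset.filter_congr fun a _ => eq_comm

/-- **Two families over equinumerous finite index types have the same multiset of values iff every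
value of the second family is taken the same number of times by both.** (⇒: count; ⇐: the second
multiset is below the first — values outside its support have count `0` — and both have the same
size.) [folklore] -/
theorem map_univ_eq_iff_card_fiber {α β γ : Type*} [Fintype α] [Fintype β] [DecidableEq γ]
    (f : α → γ) (g : β → γ) (hcard : Fintype.card α = Fintype.card β) :
    (univ : Finset α).val.map f = (univ : Finset β).val.map g ↔
      ∀ b, (univ.filter fun a => f a = g b).card = (univ.filter fun b' => g b' = g b).card := by
  constructor
  · intro h b
    rw [← count_map_univ f (g b), ← count_map_univ g (g b), h]
  · intro h
    symm
    refine Multiset.eq_of_le_of_card_le (Multiset.le_iff_count.2 fun y => ?_) ?_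
    · by_cases hy : ∃ b, g b = y
      · obtain ⟨b, rfl⟩ := hy
        rw [count_map_univ, count_map_univ, h b]
      · have : Multiset.count y ((univ : Finset β).val.map g) = 0 := by
          rw [Multiset.count_eq_zero, Multiset.mem_map]
          rintro ⟨b, -, hb⟩
          exact hy ⟨b, hb⟩
        rw [this]
        exact Nat.zero_le _
    · simp [hcard]

/-! ### Generalities on gate values -/

section GateShapes

variable (V : W m k T → Bool)

/-- A binary conjunction reads its two arguments. [folklore] -/
theorem and_two_iff (f : Fin 2 → W m k T) :
    (GateFn.and 2).2 (fun a => V (f a)) = true ↔ (V (f 0) = true ∧ V (f 1) = true) := by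
  show decide (∀ a : Fin 2, V (f a) = true) = true ↔ _
  rw [decide_eq_true_iff, Fin.forall_fin_two]

/-- A binary disjunction reads its two arguments. [folklore] -/
theorem or_two_iff (f : Fin 2 → W m k T) :
    (GateFn.or 2).2 (fun a => V (f a)) = true ↔ (V (f 0) = true ∨ V (f 1) = true) := by
  show decide (∃ a : Fin 2, V (f a) = true) = true ↔ _
  rw [decide_eq_true_iff, Fin.exists_fin_two]

/-- A negation gate negates its argument. [folklore] -/
theorem not_iff (f : Fin 1 → W m k T) : GateFn.not.2 (fun a => V (f a)) = true ↔ V (f 0) = false := by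
  show (!(V (f 0))) = true ↔ _
  cases V (f 0) <;> simp

/-- An unbounded conjunction. [folklore] -/
theorem and_fin_iff {n : ℕ} (f : Fin n → W m k T) :
    (GateFn.and n).2 (fun a => V (f a)) = true ↔ ∀ a, V (f a) = true := by
  show decide (∀ a : Fin n, V (f a) = true) = true ↔ _
  rw [decide_eq_true_iff]

/-- The number of ones of a concatenated tuple (private copy of `LabelledArithCircuit.numOnes_append`,
`AlgebraicComplexity/SymmetricThresholdTranslation.lean`, not imported to keep the closure small). [folklore] -/
private theorem numOnes_append {n₁ n₂ : ℕ} (a : Fin n₁ → Bool) (b : Fin n₂ → Bool) :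
    GateFn.numOnes (Fin.append a b) = GateFn.numOnes a + GateFn.numOnes b := by
  unfold GateFn.numOnes
  rw [Finset.card_filter, Finset.card_filter, Finset.card_filter, Fin.sum_univ_add]
  simp only [Fin.append_left, Fin.append_right]

/-- The number of ones of a tuple with a leading `false`. [folklore] -/
theorem numOnes_cons_false {n : ℕ} (a : Fin n → Bool) :
    GateFn.numOnes (Fin.cons false a : Fin (n + 1) → Bool) = GateFn.numOnes a := by
  unfold GateFn.numOnes
  rw [Finset.card_filter, Finset.card_filter, Fin.sum_univ_succ]
  simp

/-- **The padded counter**: the majority gate `MAJ_{2(n+1)}` over `(ff, f₀, …, f_{n-1})` and the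
threshold-`θ` padding fires iff at least `θ` of the wires `fᵢ` are true. [cite: AndersonDawar2016, §3 (counting by threshold gates)] -/
theorem counter_iff (hff : V (Sum.inr ff) = false) (htt : V (Sum.inr tt) = true) {n θ : ℕ}
    (f : Fin n → W m k T) :
    (GateFn.maj ((n + 1) + (n + 1))).2
        (fun a => V (Fin.append (Fin.cons (Sum.inr ff) f) (pad n θ) a)) = true ↔
      θ ≤ (univ.filter fun i => V (f i) = true).card := by
  show decide ((n + 1) + (n + 1) ≤ 2 * GateFn.numOnes
    (fun a => V (Fin.append (Fin.cons (Sum.inr ff) f) (pad n θ) a))) = true ↔ _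
  rw [decide_eq_true_iff]
  have happ : (fun a => V (Fin.append (Fin.cons (Sum.inr ff) f) (pad n θ) a)) =
      Fin.append (Fin.cons false fun i => V (f i)) (fun j => decide ((j : ℕ) + θ < n + 1)) := by
    funext a
    induction a using Fin.addCases with
    | left i =>
      rw [Fin.append_left, Fin.append_left]
      refine Fin.cases ?_ (fun i => ?_) i
      · simp [hff]
      · simp
    | right j =>
      rw [Fin.append_right, Fin.append_right]
      simp only [pad]
      split_ifs with h
      · simp [htt, h]
      · simp [hff, h]
  rw [happ, numOnes_append, numOnes_cons_false, SymCR.numOnes_decide]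
  have hdef : GateFn.numOnes (fun i => V (f i)) = (univ.filter fun i => V (f i) = true).card := rfl
  rw [hdef]
  have hA := Finset.card_filter_le (univ : Finset (Fin n)) (fun i => V (f i) = true)
  rw [Finset.card_univ, Fintype.card_fin] at hA
  rcases le_or_gt θ (n + 1) with hθ | hθ
  · rw [SymCR.card_filter_add_lt hθ]
    omega
  · have h0 : (univ.filter fun j : Fin (n + 1) => (j : ℕ) + θ < n + 1).card = 0 := by
      rw [Finset.card_eq_zero, Finset.filter_eq_empty_iff]
      intro j _
      omega
    rw [h0]
    omega

end GateShapes

/-! ### Values of the literal layer -/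

section Values

variable (tgt : Target m k T) (x : (Fin m × Fin m) ⊕ Fin m → Bool)

/-- The defining equation of gate values of `wlDAG`. [folklore] -/
theorem val_node (l : Node m k T) : (wlDAG tgt).val x l =
    (Node.fn l).2 (fun a => GateDAG.wire x ((wlDAG tgt).val x) (Node.args tgt l a)) :=
  GateDAG.val_eq _ _ _

/-- The constant-true gate. [folklore] -/
theorem val_tt : (wlDAG tgt).val x tt = true := by
  rw [val_node]
  show decide (∀ a : Fin 0, GateDAG.wire x ((wlDAG tgt).val x) (Fin.elim0 a) = true) = true
  simp

/-- The constant-false gate. [folklore] -/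
theorem val_ff : (wlDAG tgt).val x ff = false := by
  rw [val_node]
  show decide (∃ a : Fin 0, GateDAG.wire x ((wlDAG tgt).val x) (Fin.elim0 a) = true) = false
  simp

/-- The symmetrised-entry gate `ex u v = x(u,v) ∨ x(v,u)`. [folklore] -/
theorem val_ex (u v : Fin m) :
    (wlDAG tgt).val x (ex u v) = true ↔ (x (Sum.inl (u, v)) = true ∨ x (Sum.inl (v, u)) = true) := by
  rw [val_node]
  show (GateFn.or 2).2 (fun a => GateDAG.wire x ((wlDAG tgt).val x)
    (if (a : ℕ) = 0 then Sum.inl (Sum.inl (u, v)) else Sum.inl (Sum.inl (v, u)))) = true ↔ _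
  rw [or_two_iff]
  simp

/-- Its negation. [folklore] -/
theorem val_nex (u v : Fin m) :
    (wlDAG tgt).val x (nex u v) = true ↔ ¬ (x (Sum.inl (u, v)) = true ∨ x (Sum.inl (v, u)) = true) := by
  rw [val_node, ← val_ex tgt x u v]
  show GateFn.not.2 (fun a => GateDAG.wire x ((wlDAG tgt).val x) (Sum.inr (ex u v))) = true ↔ _
  rw [not_iff]
  simp

/-- The negated colour bit. [folklore] -/
theorem val_ncol (u : Fin m) : (wlDAG tgt).val x (ncol u) = true ↔ x (Sum.inr u) = false := by
  rw [val_node]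
  show GateFn.not.2 (fun a => GateDAG.wire x ((wlDAG tgt).val x) (Sum.inl (Sum.inr u))) = true ↔ _
  rw [not_iff]
  simp

variable [DecidableRel (SimpleGraph.fromRel fun u v : Fin m => x (Sum.inl (u, v)) = true).Adj]

/-- **A relation literal fires iff the two x-side vertices stand in the prescribed relation** in
the graph `SimpleGraph.fromRel (x (inl (·,·)) = true)`. [folklore] -/
theorem wire_relW (a b : Fin m) (r : Fin 3) :
    GateDAG.wire x ((wlDAG tgt).val x) (relW a b r : W m k T) = true ↔
      (if a = b then (2 : Fin 3) else
        if (SimpleGraph.fromRel fun u v : Fin m => x (Sum.inl (u, v)) = true).Adj a b then 1 else 0) = r := by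
  simp only [SimpleGraph.fromRel_adj, ne_eq]
  by_cases hab : a = b
  · subst hab
    fin_cases r <;> simp [relW, val_tt, val_ff]
  · fin_cases r
    · simp [relW, hab, val_nex]
    · simp only [relW, hab, val_ex, Fin.mk_one, Fin.isValue, ↓reduceIte, GateDAG.wire_inr,
        OfNat.one_ne_ofNat]
      cases x (Sum.inl (a, b)) <;> cases x (Sum.inl (b, a)) <;> simp
    · simp only [relW, hab, val_ff, Fin.reduceFinMk, Fin.isValue, ↓reduceIte,
        GateDAG.wire_inr, Bool.false_eq_true, false_iff]
      split_ifs <;> simp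

omit [DecidableRel (SimpleGraph.fromRel fun u v : Fin m => x (Sum.inl (u, v)) = true).Adj] in
/-- **A colour literal fires iff the colour bit is the prescribed one.** [folklore] -/
theorem wire_colW (a : Fin m) (b : Bool) :
    GateDAG.wire x ((wlDAG tgt).val x) (colW a b : W m k T) = true ↔ x (Sum.inr a) = b := by
  simp only [colW]
  cases b
  · simp [val_ncol]
  · simp

/-! ### The match layers -/

/-- Quantifying over a concatenated tuple. [folklore] -/
theorem forall_append_iff {n₁ n₂ : ℕ} {X : Type*} (f : Fin n₁ → X) (g : Fin n₂ → X) (P : X → Prop) :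
    (∀ a, P (Fin.append f g a)) ↔ (∀ i, P (f i)) ∧ ∀ j, P (g j) := by
  refine ⟨fun h => ⟨fun i => by simpa using h (Fin.castAdd n₂ i), fun j => by simpa using h (Fin.natAdd n₁ j)⟩,
    fun h a => ?_⟩
  induction a using Fin.addCases with
  | left i => simpa using h.1 i
  | right j => simpa using h.2 j

variable (H : SimpleGraph (Fin m)) [DecidableRel H.Adj] (d : Fin m → Bool)
  (hadj : ∀ i j, tgt.adj i j = decide (H.Adj i j)) (hcol : ∀ i, tgt.col i = d i)

include hadj in
/-- With the target's adjacency bits those of `H`, `relH` is the entry of the atomic type of `H`.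
[folklore] -/
theorem relH_eq (i j : Fin m) :
    relH tgt i j = (if i = j then (2 : Fin 3) else if H.Adj i j then 1 else 0) := by
  simp only [relH, hadj, decide_eq_true_eq]

include hadj hcol in
/-- **Round `0`**: `mz ū ī` fires iff the coloured atomic type of `ū` in the input is that of `ī`
in the target. [cite: CaiFurerImmerman1992, §5 (W⁰: isomorphism type of the tuple)] -/
theorem val_mz (ū ī : Fin k → Fin m) : (wlDAG tgt).val x (mz ū ī) = true ↔
    atpC (SimpleGraph.fromRel fun u v : Fin m => x (Sum.inl (u, v)) = true) (fun u => x (Sum.inr u)) ū =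
      atpC H d ī := by
  rw [val_node, atpC_eq_iff]
  show (GateFn.and (k * k + k)).2 (fun a => GateDAG.wire x ((wlDAG tgt).val x) (Fin.append
    (fun p : Fin (k * k) => relW (ū (finProdFinEquiv.symm p).1) (ū (finProdFinEquiv.symm p).2)
      (relH tgt (ī (finProdFinEquiv.symm p).1) (ī (finProdFinEquiv.symm p).2)))
    (fun j : Fin k => colW (ū j) (tgt.col (ī j))) a)) = true ↔ _
  rw [and_fin_iff]
  refine (forall_append_iff _ _ fun w => GateDAG.wire x ((wlDAG tgt).val x) w = true).trans ?_
  refine and_congr ?_ ?_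
  · simp only [wire_relW, relH_eq tgt H hadj]
    constructor
    · intro h i j
      simpa using h (finProdFinEquiv (i, j))
    · intro h p
      exact h _ _
  · simp only [wire_colW, hcol]

/-- **The extension gate** `ag t ū ī w w'`: last-column literals, the colour of `w`, and the
round-`t` matches of the substituted tuples. [folklore] -/
theorem val_ag (t : Fin T) (ū ī : Fin k → Fin m) (w w' : Fin m) :
    (wlDAG tgt).val x (ag t ū ī w w') = true ↔
      ((∀ j, (if ū j = w then (2 : Fin 3) else
          if (SimpleGraph.fromRel fun u v : Fin m => x (Sum.inl (u, v)) = true).Adj (ū j) w then 1 else 0) =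
          relH tgt (ī j) w') ∧ x (Sum.inr w) = tgt.col w') ∧
      ∀ j, GateDAG.wire x ((wlDAG tgt).val x)
        (Mw t.castSucc (Function.update ū j w) (Function.update ī j w')) = true := by
  rw [val_node]
  show (GateFn.and (k + 1 + k)).2 (fun a => GateDAG.wire x ((wlDAG tgt).val x) (Fin.append
    (Fin.append (fun j : Fin k => relW (ū j) w (relH tgt (ī j) w'))
      (fun _ : Fin 1 => colW w (tgt.col w')))
    (fun j : Fin k => Mw t.castSucc (Function.update ū j w) (Function.update ī j w')) a)) = true ↔ _
  rw [and_fin_iff]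
  refine (forall_append_iff _ _ fun w => GateDAG.wire x ((wlDAG tgt).val x) w = true).trans ?_
  refine and_congr ?_ Iff.rfl
  refine (forall_append_iff _ _ fun w => GateDAG.wire x ((wlDAG tgt).val x) w = true).trans ?_
  simp only [wire_relW, wire_colW, Fin.forall_fin_one]

omit [DecidableRel (SimpleGraph.fromRel fun u v : Fin m => x (Sum.inl (u, v)) = true).Adj] in
/-- `cge`: at least `nA t ī w'` new vertices `w` fire `ag t ū ī w w'`. [cite: AndersonDawar2016, §3 (counting by threshold gates)] -/
theorem val_cge (t : Fin T) (ū ī : Fin k → Fin m) (w' : Fin m) :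
    (wlDAG tgt).val x (cge t ū ī w') = true ↔
      tgt.nA t ī w' ≤ (univ.filter fun w => (wlDAG tgt).val x (ag t ū ī w w') = true).card := by
  rw [val_node]
  show (GateFn.maj ((m + 1) + (m + 1))).2 (fun a => GateDAG.wire x ((wlDAG tgt).val x)
    (Fin.append (Fin.cons (Sum.inr ff) fun w => Sum.inr (ag t ū ī w w')) (pad m (tgt.nA t ī w')) a)) = true ↔ _
  rw [counter_iff _ (by simp [val_ff]) (by simp [val_tt])]
  simp only [GateDAG.wire_inr]

omit [DecidableRel (SimpleGraph.fromRel fun u v : Fin m => x (Sum.inl (u, v)) = true).Adj] in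
/-- `cgt`: at least `nA t ī w' + 1` of them. [folklore] -/
theorem val_cgt (t : Fin T) (ū ī : Fin k → Fin m) (w' : Fin m) :
    (wlDAG tgt).val x (cgt t ū ī w') = true ↔
      tgt.nA t ī w' + 1 ≤ (univ.filter fun w => (wlDAG tgt).val x (ag t ū ī w w') = true).card := by
  rw [val_node]
  show (GateFn.maj ((m + 1) + (m + 1))).2 (fun a => GateDAG.wire x ((wlDAG tgt).val x)
    (Fin.append (Fin.cons (Sum.inr ff) fun w => Sum.inr (ag t ū ī w w'))
      (pad m (tgt.nA t ī w' + 1)) a)) = true ↔ _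
  rw [counter_iff _ (by simp [val_ff]) (by simp [val_tt])]
  simp only [GateDAG.wire_inr]

omit [DecidableRel (SimpleGraph.fromRel fun u v : Fin m => x (Sum.inl (u, v)) = true).Adj] in
/-- `ceq`: EXACTLY `nA t ī w'` of them. [folklore] -/
theorem val_ceq (t : Fin T) (ū ī : Fin k → Fin m) (w' : Fin m) :
    (wlDAG tgt).val x (ceq t ū ī w') = true ↔
      (univ.filter fun w => (wlDAG tgt).val x (ag t ū ī w w') = true).card = tgt.nA t ī w' := by
  have hn : (wlDAG tgt).val x (ncgt t ū ī w') = true ↔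
      ¬ (tgt.nA t ī w' + 1 ≤ (univ.filter fun w => (wlDAG tgt).val x (ag t ū ī w w') = true).card) := by
    rw [val_node, ← val_cgt tgt x t ū ī w']
    show GateFn.not.2 (fun a => GateDAG.wire x ((wlDAG tgt).val x) (Sum.inr (cgt t ū ī w'))) = true ↔ _
    rw [not_iff]
    simp
  rw [val_node]
  show (GateFn.and 2).2 (fun a => GateDAG.wire x ((wlDAG tgt).val x)
    (if (a : ℕ) = 0 then Sum.inr (cge t ū ī w') else Sum.inr (ncgt t ū ī w'))) = true ↔ _
  rw [and_two_iff]
  simp only [Fin.val_zero, ↓reduceIte, Fin.val_one, one_ne_zero, GateDAG.wire_inr, val_cge, hn]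
  omega

omit [DecidableRel (SimpleGraph.fromRel fun u v : Fin m => x (Sum.inl (u, v)) = true).Adj] in
/-- **Round `t + 1`**: `ms t ū ī` fires iff the round-`t` match holds and all the exact counts do.
[cite: CaiFurerImmerman1992, §5 (the refinement step)] -/
theorem val_ms (t : Fin T) (ū ī : Fin k → Fin m) : (wlDAG tgt).val x (ms t ū ī) = true ↔
    GateDAG.wire x ((wlDAG tgt).val x) (Mw t.castSucc ū ī) = true ∧
      ∀ w', (univ.filter fun w => (wlDAG tgt).val x (ag t ū ī w w') = true).card = tgt.nA t ī w' := by
  rw [val_node]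
  show decide (∀ a : Fin (m + 1), GateDAG.wire x ((wlDAG tgt).val x)
    ((Fin.cons (Mw t.castSucc ū ī) (fun w' => Sum.inr (ceq t ū ī w')) : Fin (m + 1) → W m k T) a) =
      true) = true ↔ _
  rw [decide_eq_true_iff, Fin.forall_fin_succ]
  simp only [Fin.cons_zero, Fin.cons_succ, GateDAG.wire_inr, val_ceq]

/-! ### The induction over the rounds -/

variable (hnA : ∀ (t : Fin T) (ī : Fin k → Fin m) (w' : Fin m), tgt.nA t ī w' =
    (univ.filter fun w'' : Fin m =>
      (atpC H d (Fin.snoc ī w'' : Fin (k + 1) → Fin m), fun j => wlColourC H d (t : ℕ) (Function.update ī j w'')) =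
      (atpC H d (Fin.snoc ī w' : Fin (k + 1) → Fin m), fun j => wlColourC H d (t : ℕ) (Function.update ī j w'))).card)

include hadj hcol hnA in
/-- **The match wires compute equality of coloured `k`-WL colours with the target**: for every round
`t ≤ T` and all tuples, the wire `Mw t ū ī` carries `[C_t(G, c; ū) = C_t(H, d; ī)]`, where `(G, c)`
is the coloured graph read off the input. (Induction on `t`; the step combines `val_ms`, the
extension gate evaluated under the round-`t` match — the new vertex `w` over `ū` realises the same
value `(atpC(ū w), (C_t(ū[j ↦ w]))ⱼ)` as `w'` over `ī` —, and the fibre-count criterion for equality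
of the two refinement multisets.) [cite: AndersonDawar2016, Thm 1 (FPC to symmetric circuits)] -/
theorem val_Mw : ∀ (t : ℕ) (ht : t < T + 1) (ū ī : Fin k → Fin m),
    GateDAG.wire x ((wlDAG tgt).val x) (Mw ⟨t, ht⟩ ū ī) = true ↔
      wlColourC (SimpleGraph.fromRel fun u v : Fin m => x (Sum.inl (u, v)) = true)
        (fun u => x (Sum.inr u)) t ū = wlColourC H d t ī
  | 0, h0, ū, ī => by
    show (wlDAG tgt).val x (mz ū ī) = true ↔ _
    rw [val_mz tgt x H d hadj hcol]
    rfl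
  | t + 1, ht, ū, ī => by
    have ht' : t < T := by omega
    have IH : ∀ ū' ī' : Fin k → Fin m, GateDAG.wire x ((wlDAG tgt).val x)
        (Mw (Fin.castSucc ⟨t, ht'⟩) ū' ī') = true ↔
        wlColourC (SimpleGraph.fromRel fun u v : Fin m => x (Sum.inl (u, v)) = true)
          (fun u => x (Sum.inr u)) t ū' = wlColourC H d t ī' :=
      fun ū' ī' => val_Mw t (by omega) ū' ī'
    show (wlDAG tgt).val x (ms ⟨t, ht'⟩ ū ī) = true ↔ _
    rw [val_ms, IH, wlColourC_succ, wlColourC_succ]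
    refine Iff.trans ?_ Prod.mk_inj.symm
    refine and_congr_right fun hC => ?_
    -- under the round-`t` match, `ag` fires iff the values of the new vertices agree
    have hatp : atpC (SimpleGraph.fromRel fun u v : Fin m => x (Sum.inl (u, v)) = true)
        (fun u => x (Sum.inr u)) ū = atpC H d ī :=
      wlColourC_eq_of_le (Nat.zero_le t) hC
    have hag : ∀ w w' : Fin m, (wlDAG tgt).val x (ag ⟨t, ht'⟩ ū ī w w') = true ↔
        (atpC (SimpleGraph.fromRel fun u v : Fin m => x (Sum.inl (u, v)) = true) (fun u => x (Sum.inr u))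
            (Fin.snoc ū w : Fin (k + 1) → Fin m),
          fun j => wlColourC (SimpleGraph.fromRel fun u v : Fin m => x (Sum.inl (u, v)) = true)
            (fun u => x (Sum.inr u)) t (Function.update ū j w)) =
        (atpC H d (Fin.snoc ī w' : Fin (k + 1) → Fin m), fun j => wlColourC H d t (Function.update ī j w')) := by
      intro w w'
      rw [val_ag, Prod.mk.injEq, atpC_snoc_eq_iff hatp, funext_iff]
      simp only [relH_eq tgt H hadj, hcol, IH]
    have hcount : ∀ w', (univ.filter fun w => (wlDAG tgt).val x (ag ⟨t, ht'⟩ ū ī w w') = true) =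
        univ.filter fun w =>
          (atpC (SimpleGraph.fromRel fun u v : Fin m => x (Sum.inl (u, v)) = true) (fun u => x (Sum.inr u))
              (Fin.snoc ū w : Fin (k + 1) → Fin m),
            fun j => wlColourC (SimpleGraph.fromRel fun u v : Fin m => x (Sum.inl (u, v)) = true)
              (fun u => x (Sum.inr u)) t (Function.update ū j w)) =
          (atpC H d (Fin.snoc ī w' : Fin (k + 1) → Fin m), fun j => wlColourC H d t (Function.update ī j w')) :=
      fun w' => Finset.filter_congr fun w _ => hag w w'
    simp only [hnA, hcount]
    exact (map_univ_eq_iff_card_fiber _ _ rfl).symm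

/-! ### The output layer -/

variable (hnO : ∀ ī : Fin k → Fin m, tgt.nO ī =
  (univ.filter fun ā : Fin k → Fin m => wlColourC H d T ā = wlColourC H d T ī).card)

omit [DecidableRel (SimpleGraph.fromRel fun u v : Fin m => x (Sum.inl (u, v)) = true).Adj] in
/-- Counting over the codes of tuples is counting over tuples. [folklore] -/
theorem card_filter_code (P : (Fin k → Fin m) → Prop) [DecidablePred P] :
    (univ.filter fun c : Fin (m ^ k) => P (finFunctionFinEquiv.symm c)).card = (univ.filter P).card := by
  rw [← Finset.card_map finFunctionFinEquiv.symm.toEmbedding]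
  congr 1
  ext ū
  simp only [Finset.mem_map_equiv, Finset.mem_filter, Finset.mem_univ, true_and, Equiv.symm_symm,
    Equiv.symm_apply_apply]

omit [DecidableRel (SimpleGraph.fromRel fun u v : Fin m => x (Sum.inl (u, v)) = true).Adj] in
/-- `oge ī`: at least `nO ī` tuples match `ī` at the last round. [folklore] -/
theorem val_oge (ī : Fin k → Fin m) : (wlDAG tgt).val x (oge ī) = true ↔
    tgt.nO ī ≤ (univ.filter fun ū => GateDAG.wire x ((wlDAG tgt).val x) (Mw (Fin.last T) ū ī) = true).card := by
  rw [val_node]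
  show (GateFn.maj ((m ^ k + 1) + (m ^ k + 1))).2 (fun a => GateDAG.wire x ((wlDAG tgt).val x)
    (Fin.append (Fin.cons (Sum.inr ff) fun c => Mw (Fin.last T) (finFunctionFinEquiv.symm c) ī)
      (pad (m ^ k) (tgt.nO ī)) a)) = true ↔ _
  rw [counter_iff _ (by simp [val_ff]) (by simp [val_tt]),
    card_filter_code (fun ū => GateDAG.wire x ((wlDAG tgt).val x) (Mw (Fin.last T) ū ī) = true)]

omit [DecidableRel (SimpleGraph.fromRel fun u v : Fin m => x (Sum.inl (u, v)) = true).Adj] in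
/-- `ogt ī`: at least `nO ī + 1` of them. [folklore] -/
theorem val_ogt (ī : Fin k → Fin m) : (wlDAG tgt).val x (ogt ī) = true ↔
    tgt.nO ī + 1 ≤ (univ.filter fun ū => GateDAG.wire x ((wlDAG tgt).val x) (Mw (Fin.last T) ū ī) = true).card := by
  rw [val_node]
  show (GateFn.maj ((m ^ k + 1) + (m ^ k + 1))).2 (fun a => GateDAG.wire x ((wlDAG tgt).val x)
    (Fin.append (Fin.cons (Sum.inr ff) fun c => Mw (Fin.last T) (finFunctionFinEquiv.symm c) ī)
      (pad (m ^ k) (tgt.nO ī + 1)) a)) = true ↔ _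
  rw [counter_iff _ (by simp [val_ff]) (by simp [val_tt]),
    card_filter_code (fun ū => GateDAG.wire x ((wlDAG tgt).val x) (Mw (Fin.last T) ū ī) = true)]

omit [DecidableRel (SimpleGraph.fromRel fun u v : Fin m => x (Sum.inl (u, v)) = true).Adj] in
/-- `oeq ī`: EXACTLY `nO ī` of them. [folklore] -/
theorem val_oeq (ī : Fin k → Fin m) : (wlDAG tgt).val x (oeq ī) = true ↔
    (univ.filter fun ū => GateDAG.wire x ((wlDAG tgt).val x) (Mw (Fin.last T) ū ī) = true).card = tgt.nO ī := by
  have hn : (wlDAG tgt).val x (nogt ī) = true ↔ ¬ (tgt.nO ī + 1 ≤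
      (univ.filter fun ū => GateDAG.wire x ((wlDAG tgt).val x) (Mw (Fin.last T) ū ī) = true).card) := by
    rw [val_node, ← val_ogt tgt x ī]
    show GateFn.not.2 (fun a => GateDAG.wire x ((wlDAG tgt).val x) (Sum.inr (ogt ī))) = true ↔ _
    rw [not_iff]
    simp
  rw [val_node]
  show (GateFn.and 2).2 (fun a => GateDAG.wire x ((wlDAG tgt).val x)
    (if (a : ℕ) = 0 then Sum.inr (oge ī) else Sum.inr (nogt ī))) = true ↔ _
  rw [and_two_iff]
  simp only [Fin.val_zero, ↓reduceIte, Fin.val_one, one_ne_zero, GateDAG.wire_inr, val_oge, hn]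
  omega

include hadj hcol hnA hnO in
/-- **The output gate computes equality of the round-`T` colour multisets.** [cite: AndersonDawar2016, Thm 1 (FPC to symmetric circuits)] -/
theorem val_out : (wlDAG tgt).val x out = true ↔
    wlColoursC k (SimpleGraph.fromRel fun u v : Fin m => x (Sum.inl (u, v)) = true) (fun u => x (Sum.inr u)) T =
      wlColoursC k H d T := by
  rw [val_node]
  show (GateFn.and (m ^ k)).2 (fun a => GateDAG.wire x ((wlDAG tgt).val x)
    (Sum.inr (oeq (finFunctionFinEquiv.symm a)))) = true ↔ _
  rw [and_fin_iff]
  simp only [GateDAG.wire_inr, val_oeq, hnO]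
  have hM : ∀ ū ī : Fin k → Fin m, GateDAG.wire x ((wlDAG tgt).val x) (Mw (Fin.last T) ū ī) = true ↔
      wlColourC (SimpleGraph.fromRel fun u v : Fin m => x (Sum.inl (u, v)) = true) (fun u => x (Sum.inr u)) T ū =
        wlColourC H d T ī := fun ū ī => val_Mw tgt x H d hadj hcol hnA T (Nat.lt_succ_self T) ū ī
  have hfilt : ∀ ī : Fin k → Fin m,
      (univ.filter fun ū => GateDAG.wire x ((wlDAG tgt).val x) (Mw (Fin.last T) ū ī) = true) =
        univ.filter fun ū =>
          wlColourC (SimpleGraph.fromRel fun u v : Fin m => x (Sum.inl (u, v)) = true) (fun u => x (Sum.inr u))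
            T ū = wlColourC H d T ī :=
    fun ī => Finset.filter_congr fun ū _ => hM ū ī
  simp only [hfilt]
  constructor
  · intro h
    exact (map_univ_eq_iff_card_fiber _ _ rfl).2 fun ī => by simpa using h (finFunctionFinEquiv ī)
  · intro h a
    exact (map_univ_eq_iff_card_fiber _ _ rfl).1 h _

include hadj hcol hnA hnO in
/-- **The compiled circuit decides equality of the round-`T` colour multisets with the target's.**
[cite: AndersonDawar2016, Thm 1 (FPC to symmetric circuits)] -/
theorem compile_wlDAG_eval_iff : (wlDAG tgt).compile.eval x = true ↔
    wlColoursC k (SimpleGraph.fromRel fun u v : Fin m => x (Sum.inl (u, v)) = true) (fun u => x (Sum.inr u)) T =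
      wlColoursC k H d T := by
  rw [GateDAG.compile_eval]
  exact val_out tgt x H d hadj hcol hnA hnO

include hadj hcol hnA hnO in
/-- **With `T ≥ m^k · m^k` rounds the compiled circuit decides coloured `k`-WL equivalence with the
target** (the explicit stable round of `WeisfeilerLemanColoured.lean`). [cite: AndersonDawar2016, Thm 1 (FPC to symmetric circuits)] -/
theorem compile_wlDAG_eval_iff_wlEquivC (hT : m ^ k * m ^ k ≤ T) : (wlDAG tgt).compile.eval x = true ↔
    WLEquivC k (SimpleGraph.fromRel fun u v : Fin m => x (Sum.inl (u, v)) = true) (fun u => x (Sum.inr u))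
      H d := by
  rw [compile_wlDAG_eval_iff tgt x H d hadj hcol hnA hnO]
  have hT' : Fintype.card (Fin k → Fin m) * Fintype.card (Fin k → Fin m) ≤ T := by simpa using hT
  exact (wlEquivC_iff_wlColoursC_eq hT').symm

end Values

end SymWL

end Literature.Computability.Complexity
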